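import Literature.Dynamics.Ergodic.ToralEndomorphismsExact
import Literature.Dynamics.Ergodic.ToralAffineMixing
import HarnessLib

/-!
# Exactness of the affine maps `x ↦ T_A x + c` of a torus: an affine map is exact iff its linear part is
# (Andersen–Thomsen, Theorem 4.3; Krzyżewski's criterion)

Layer `Literature/Dynamics/Ergodic`, namespace `Literature.Dynamics.Ergodic` (sub-namespace `ToralEndomorphism`);
sequel of `ToralEndomorphismsExact.lean` (Rohlin's criterion `⋂ₙ ℤ^d Aⁿ = 0` and Krzyżewski's theorem for the
endomorphisms `T_A` of Mathlib's `UnitAddTorus d`, Walters' Definition 4.14 `IsExactEndomorphism`) and of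
`ToralAffineMixing.lean` (the affine maps `S x = T_A x + c`, their iterates `Sⁿ x = T_Aⁿ x + Sⁿ 0`, Walters'
Theorem 1.29: `S` strong-mixing ⟺ `T_A` ergodic).  Written for lane `lit-hodgefound` (prover seat `lit-hodgefound-p31`).

## The printed statements

K. K. S. Andersen, K. Thomsen, *The C\*-algebra of an affine map on the 3-torus*, Doc. Math. 17 (2012) (held
text arXiv:1204.0224 chunk p0010), **Theorem 4.3.** «Let `A ∈ M_n(ℤ)` be an integral matrix with non-zero
determinant and let `f_A(x) = Det(x1 − A)` be the characteristic polynomial of `A`. […] 1) If no unimodular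
polynomial divides `f_A` every affine local homeomorphism of `𝕋ⁿ` with `φ_A` as linear part is exact and conjugate
to `φ_A`. 2) If `k ≥ 1` [the multiplicity of the root `1`] but no unimodular polynomial divides `g` […] In this case
no affine local homeomorphism with `φ_A` as linear part is exact.» and, in its proof, «Note that an affine map is
exact if and only if its linear part is.»; **Theorem 4.1** (Krzyżewski): «The group endomorphism `φ_A` of `𝕋ⁿ` is
strongly transitive [⟺ exact, Prop. 2.9] if and only if no unimodular polynomial divides `f_A`.»  (Andersen–Thomsen
work with topological exactness; the statements are proved here for Rohlin's measure-theoretic exactness with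
respect to the Haar probability measure, Walters' Definition 4.14, by the Fourier argument of
`ToralEndomorphismsExact.lean` — the two σ-algebras `S⁻ⁿ𝓑` and `T_A⁻ⁿ𝓑` consist of the same sets, those invariant
under `ker T_Aⁿ`.)  P. Walters, *An Introduction to Ergodic Theory* (1982), §4.9 Def. 4.14 and «Exact endomorphisms
[…] are strong-mixing» (held chunk p0126); §1.7 Theorem 1.29 (affine transformations).

## What is formalised (theorems only; no definition, no named fact)

For `A ∈ M_d(ℤ)`, `T = T_A` (hypothesis `hT` as in `ToralEndomorphisms.lean`), `c ∈ 𝕋^d` and `S x = T x + c`: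
* §1 `mFourierCoeff_indicator_preimage_iterate_add_const_eq_zero` (a set `S⁻ⁿ t` has no Fourier coefficients off
  `ℤ^d Aⁿ`), **`isTailTrivial_add_const_of_forall_exists`** (`⋂ₙ ℤ^d Aⁿ = 0 ⟹ 𝓑_∞(S) ≗ 𝓝`, `det A ≠ 0`);
* §2 `measurableSet_tail_add_const_preimage_mFourier` (a character `χ_m`, `m ∈ ⋂ₙ ℤ^d Aⁿ`, is `𝓑_∞(S)`-measurable:
  `χ_m = χ_{k_n}(Sⁿ0)⁻¹ · χ_{k_n} ∘ Sⁿ`), `not_isTailTrivial_add_const_of_forall_exists`;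
* §3 **`isExactEndomorphism_add_const_iff_forall_exists`** (Rohlin's criterion for `S`),
  **`isExactEndomorphism_add_const_iff`** («an affine map is exact iff its linear part is»),
  **`isExactEndomorphism_add_const_iff_forall_not_dvd_charpoly`** (Theorem 4.3 in measure form: `S` exact ⟺ no
  unimodular polynomial divides `χ_A`), `isExactEndomorphism_add_const_of_forall_one_lt_norm`,
  `not_isExactEndomorphism_add_const_of_isUnit_det`, and **`mixing_add_const_of_isExactEndomorphism`** (an exact
  affine map is strong-mixing — Walters' remark, through Theorem 1.29).

## References

* [AndersenThomsen2012] K. K. S. Andersen, K. Thomsen, Doc. Math. 17 (2012) 545–572, §4 Theorems 4.1, 4.3 and the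
  proof of 4.3 (held text arXiv:1204.0224 chunk p0010); §2.5 Prop. 2.9 (chunk p0007).
* [Krzyzewski1993] K. Krzyżewski, *On exact toral endomorphisms*, Monatsh. Math. 116 (1993) 39–47 (cite-only).
* [Walters1982] P. Walters, *An Introduction to Ergodic Theory*, GTM 79 (1982), §4.9 Definition 4.14 (held text
  chunk p0126), §1.7 Theorem 1.29 (chunk p0063).
* [CuntzVershik2012] J. Cuntz, A. Vershik, Comm. Math. Phys. 321 (2013), §2 (held text arXiv:1202.5960 chunk p0005).
-/

noncomputable section

open MeasureTheory MeasureTheory.Measure Set Filter Function Finset Matrix Polynomial Topology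
open scoped ENNReal

namespace Literature.Dynamics.Ergodic

namespace ToralEndomorphism

variable {d : Type*} [Fintype d] [DecidableEq d] (A : Matrix d d ℤ)
  {T : UnitAddTorus d → UnitAddTorus d} (hT : ∀ x i, T x i = ∑ j, A i j • x j)

/-! ### §1 `⋂ₙ ℤ^d Aⁿ = 0` ⟹ the tail σ-algebra of `S x = T_A x + c` is trivial -/

omit [DecidableEq d] in
/-- If the indicator function of a set is a.e. equal to a constant, the set is a.e. empty or a.e. everything.
[folklore] -/
private theorem eventuallyConst_of_indicator_ae_eq_const' {s : Set (UnitAddTorus d)} {c : ℂ}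
    (h : s.indicator (fun _ ↦ (1 : ℂ)) =ᵐ[volume] fun _ ↦ c) : EventuallyConst s (ae volume) := by
  rw [eventuallyConst_set]
  by_cases hc : c = 1
  · left
    filter_upwards [h] with x hx
    by_contra hxs
    rw [indicator_of_notMem hxs, hc] at hx
    exact zero_ne_one hx
  · right
    filter_upwards [h] with x hx hxs
    rw [indicator_of_mem hxs] at hx
    exact hc hx.symm

include hT in
/-- **A set `S⁻ⁿ t` has no Fourier coefficients off `ℤ^d Aⁿ`** (`S x = T_A x + c`, `det A ≠ 0`): since
`Sⁿ x = T_Aⁿ x + Sⁿ 0`, `1_{S⁻ⁿt} = (1_t ∘ τ_{Sⁿ0}) ∘ T_Aⁿ`, and `ToralEndomorphism.mFourierCoeff_comp_iterate_eq_zero`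
applies. [cite: AndersenThomsen2012, §4 proof of Theorem 4.3, «an affine map is exact if and only if its linear part is» (held text arXiv:1204.0224 chunk p0010)] -/
theorem mFourierCoeff_indicator_preimage_iterate_add_const_eq_zero (hA : A.det ≠ 0) (c : UnitAddTorus d)
    (t : Set (UnitAddTorus d)) {m : d → ℤ} {n : ℕ} (hm : ∀ k : d → ℤ, k ᵥ* A ^ n ≠ m) :
    UnitAddTorus.mFourierCoeff (((fun y ↦ T y + c)^[n] ⁻¹' t).indicator fun _ ↦ (1 : ℂ)) m = 0 := by
  have hind : ((fun y ↦ T y + c)^[n] ⁻¹' t).indicator (fun _ ↦ (1 : ℂ)) =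
      (fun z ↦ t.indicator (fun _ ↦ (1 : ℂ)) (z + (fun y ↦ T y + c)^[n] 0)) ∘ T^[n] := by
    funext x
    rw [Function.comp_apply, ← iterate_add_const_apply A hT c n x]
    exact indicator_comp_right ((fun y ↦ T y + c)^[n]) (s := t) (g := fun _ ↦ (1 : ℂ))
  rw [hind]
  exact mFourierCoeff_comp_iterate_eq_zero A hT hA _ hm

include hT in
/-- **`⋂ₙ ℤ^d Aⁿ = 0 ⟹` the tail σ-algebra of `S x = T_A x + c` is trivial** (`det A ≠ 0`): a tail-measurable
set has vanishing coefficients `ĉ_m(1_s)`, `m ≠ 0`, hence `1_s` is a.e. constant.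
[cite: AndersenThomsen2012, §4 Theorem 4.3 (1) and its proof (held text arXiv:1204.0224 chunk p0010)]
[cite: Walters1982, §4.9 Definition 4.14 (held text chunk p0126)] -/
theorem isTailTrivial_add_const_of_forall_exists (hA : A.det ≠ 0) (c : UnitAddTorus d)
    (h : ∀ m : d → ℤ, m ≠ 0 → ∃ n : ℕ, ∀ k : d → ℤ, k ᵥ* A ^ n ≠ m) :
    IsTailTrivial (fun y ↦ T y + c) volume := by
  refine ⟨fun s hs ↦ ?_⟩
  have hsm : MeasurableSet s := measurableSet_of_tailMeasurableSpace hs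
  have hmem : MemLp (s.indicator fun _ ↦ (1 : ℂ)) 2 (volume : Measure (UnitAddTorus d)) :=
    memLp_indicator_const 2 hsm (1 : ℂ) (Or.inr (measure_ne_top _ s))
  have hzero : ∀ m : d → ℤ, m ≠ 0 → UnitAddTorus.mFourierCoeff (s.indicator fun _ ↦ (1 : ℂ)) m = 0 := by
    intro m hm
    obtain ⟨n, hn⟩ := h m hm
    obtain ⟨t, -, rfl⟩ := measurableSet_tailMeasurableSpace_iff.1 hs n
    exact mFourierCoeff_indicator_preimage_iterate_add_const_eq_zero A hT hA c t hn
  exact eventuallyConst_of_indicator_ae_eq_const'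
    (ToralTranslation.ae_eq_const_of_forall_mFourierCoeff_eq_zero hmem hzero)

/-! ### §2 A character `χ_m`, `0 ≠ m ∈ ⋂ₙ ℤ^d Aⁿ`, is tail-measurable for `S` -/

include hT in
/-- **`χ_m` with `m ∈ ⋂ₙ ℤ^d Aⁿ` is `𝓑_∞(S)`-measurable**: from `m = k_n Aⁿ` and `Sⁿ x = T_Aⁿ x + Sⁿ 0`,
`χ_{k_n}(Sⁿ x) = χ_m(x) χ_{k_n}(Sⁿ 0)`, so `χ_m⁻¹(U) = S⁻ⁿ {y : χ_{k_n}(Sⁿ0)⁻¹ χ_{k_n}(y) ∈ U}`.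
[cite: AndersenThomsen2012, §4 Theorem 4.3 (2) and its proof (held text arXiv:1204.0224 chunk p0010)]
[cite: Walters1982, §4.9 Definition 4.14 (held text chunk p0126)] -/
theorem measurableSet_tail_add_const_preimage_mFourier (c : UnitAddTorus d) {m : d → ℤ}
    (hm : ∀ n : ℕ, ∃ k : d → ℤ, k ᵥ* A ^ n = m) {U : Set ℂ} (hU : MeasurableSet U) :
    MeasurableSet[tailMeasurableSpace fun y ↦ T y + c] (UnitAddTorus.mFourier m ⁻¹' U) := by
  refine measurableSet_tailMeasurableSpace_iff.2 fun n ↦ ?_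
  obtain ⟨k, hk⟩ := hm n
  set w : ℂ := UnitAddTorus.mFourier k ((fun y ↦ T y + c)^[n] 0) with hw
  have hw0 : w ≠ 0 := by
    intro h0
    obtain ⟨x, hx⟩ : ∃ x : d → ℝ, (fun i ↦ ((x i : ℝ) : UnitAddCircle)) = (fun y ↦ T y + c)^[n] 0 :=
      ⟨fun i ↦ Classical.choose (QuotientAddGroup.mk_surjective (((fun y ↦ T y + c)^[n] 0) i)),
        funext fun i ↦ Classical.choose_spec (QuotientAddGroup.mk_surjective (((fun y ↦ T y + c)^[n] 0) i))⟩
    rw [hw, ← hx, mFourier_coe] at h0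
    exact Complex.exp_ne_zero _ h0
  refine ⟨(fun y ↦ w⁻¹ * UnitAddTorus.mFourier k y) ⁻¹' U,
    (continuous_const.mul (UnitAddTorus.mFourier k).continuous).measurable hU, ?_⟩
  ext x
  simp only [Set.mem_preimage]
  rw [iterate_add_const_apply A hT c n x, ToralTranslation.mFourier_apply_add, mFourier_iterate_apply A hT k n x, hk,
    ← hw, mul_comm (UnitAddTorus.mFourier m x) w, ← mul_assoc, inv_mul_cancel₀ hw0, one_mul]

omit [DecidableEq d] in
/-- The Haar probability measure of the torus charges non-empty open sets. [folklore] -/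
private theorem isOpenPosMeasure_volume' : (volume : Measure (UnitAddTorus d)).IsOpenPosMeasure := by
  rw [MeasureTheory.volume_pi]
  infer_instance

omit [DecidableEq d] in
/-- A self-map of the torus for which every level set `χ_m⁻¹(U)` (`U ⊆ ℂ` measurable) of a NON-TRIVIAL character is
tail-measurable does not have a trivial tail σ-algebra: `{Re χ_m < 0}` and `{Re χ_m > 0} ⊆ {Re χ_m < 0}ᶜ` are
non-empty open sets. [cite: Walters1982, §4.9 Definition 4.14 (held text chunk p0126)] -/
private theorem not_isTailTrivial_of_forall_measurableSet_tail {S : UnitAddTorus d → UnitAddTorus d} {m : d → ℤ}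
    (hm0 : m ≠ 0)
    (hm : ∀ U : Set ℂ, MeasurableSet U → MeasurableSet[tailMeasurableSpace S] (UnitAddTorus.mFourier m ⁻¹' U)) :
    ¬ IsTailTrivial S volume := by
  intro h
  haveI := isOpenPosMeasure_volume' (d := d)
  set s : Set (UnitAddTorus d) := UnitAddTorus.mFourier m ⁻¹' {z : ℂ | z.re < 0} with hs
  have hUo : IsOpen {z : ℂ | z.re < 0} := isOpen_lt Complex.continuous_re continuous_const
  have hstail : MeasurableSet[tailMeasurableSpace S] s := hm _ hUo.measurableSet
  have hso : IsOpen s := hUo.preimage (UnitAddTorus.mFourier m).continuous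
  obtain ⟨y, hy⟩ := exists_mFourier_eq_neg_one hm0
  have hys : y ∈ s := by
    change (UnitAddTorus.mFourier m y).re < 0
    rw [hy]; norm_num
  have h0s : (0 : UnitAddTorus d) ∈ UnitAddTorus.mFourier m ⁻¹' {z : ℂ | 0 < z.re} := by
    change 0 < (UnitAddTorus.mFourier m 0).re
    have h1 : UnitAddTorus.mFourier m (0 : UnitAddTorus d) = 1 := by
      have h2 : (fun _ : d ↦ (((0 : ℝ) : ℝ) : UnitAddCircle)) = (0 : UnitAddTorus d) := by
        funext i; simp
      rw [← h2, mFourier_coe]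
      simp
    rw [h1]; norm_num
  have hpos1 : 0 < volume s := hso.measure_pos volume ⟨y, hys⟩
  have hpos2 : 0 < volume sᶜ := by
    refine lt_of_lt_of_le (((isOpen_lt continuous_const Complex.continuous_re).preimage
      (UnitAddTorus.mFourier m).continuous).measure_pos volume ⟨0, h0s⟩) (measure_mono ?_)
    intro x hx hxs
    change 0 < (UnitAddTorus.mFourier m x).re at hx
    change (UnitAddTorus.mFourier m x).re < 0 at hxs
    exact lt_asymm hx hxs
  rcases isTailTrivial_iff_measure.1 h s hstail with h' | h'
  · exact hpos1.ne' h'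
  · exact hpos2.ne' h'

include hT in
/-- **`0 ≠ m ∈ ⋂ₙ ℤ^d Aⁿ ⟹` the tail σ-algebra of `S x = T_A x + c` is NOT trivial** (no hypothesis on
`det A`). [cite: AndersenThomsen2012, §4 Theorem 4.3 (2) (held text arXiv:1204.0224 chunk p0010)]
[cite: Walters1982, §4.9 Definition 4.14 (held text chunk p0126)] -/
theorem not_isTailTrivial_add_const_of_forall_exists (c : UnitAddTorus d) {m : d → ℤ} (hm0 : m ≠ 0)
    (hm : ∀ n : ℕ, ∃ k : d → ℤ, k ᵥ* A ^ n = m) : ¬ IsTailTrivial (fun y ↦ T y + c) volume :=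
  not_isTailTrivial_of_forall_measurableSet_tail hm0
    fun _ hU ↦ measurableSet_tail_add_const_preimage_mFourier A hT c hm hU

/-! ### §3 The criteria for `S x = T_A x + c` -/

include hT in
/-- **`S x = T_A x + c` preserves the Haar probability measure** (`det A ≠ 0`). [cite: Walters1982, §1.7 Theorem 1.29 (held text chunk p0063)] -/
theorem measurePreserving_add_const (hA : A.det ≠ 0) (c : UnitAddTorus d) :
    MeasurePreserving (fun y ↦ T y + c) volume volume :=
  (measurePreserving_add_right volume c).comp (measurePreserving A hT hA)

include hT in
/-- **Rohlin's criterion for the affine map `S x = T_A x + c`** (`det A ≠ 0`): the tail σ-algebra of `S` is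
trivial for the Haar measure iff `⋂ₙ ℤ^d Aⁿ = {0}`. [cite: AndersenThomsen2012, §4 Theorem 4.3 and its proof (held text arXiv:1204.0224 chunk p0010)]
[cite: CuntzVershik2012, §2 (held text arXiv:1202.5960 chunk p0005)] -/
theorem isTailTrivial_add_const_iff_forall_exists (hA : A.det ≠ 0) (c : UnitAddTorus d) :
    IsTailTrivial (fun y ↦ T y + c) volume ↔ ∀ m : d → ℤ, m ≠ 0 → ∃ n : ℕ, ∀ k : d → ℤ, k ᵥ* A ^ n ≠ m := by
  refine ⟨fun h m hm0 ↦ ?_, isTailTrivial_add_const_of_forall_exists A hT hA c⟩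
  by_contra hc
  push Not at hc
  exact not_isTailTrivial_add_const_of_forall_exists A hT c hm0 hc h

include hT in
/-- **Rohlin's criterion: `S x = T_A x + c` is an exact endomorphism of `(𝕋^d, Haar)` iff `⋂ₙ ℤ^d Aⁿ = {0}`**
(`det A ≠ 0`). [cite: AndersenThomsen2012, §4 Theorem 4.3 and its proof (held text arXiv:1204.0224 chunk p0010)]
[cite: CuntzVershik2012, §2 (held text arXiv:1202.5960 chunk p0005)] -/
theorem isExactEndomorphism_add_const_iff_forall_exists (hA : A.det ≠ 0) (c : UnitAddTorus d) :
    IsExactEndomorphism (fun y ↦ T y + c) volume ↔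
      ∀ m : d → ℤ, m ≠ 0 → ∃ n : ℕ, ∀ k : d → ℤ, k ᵥ* A ^ n ≠ m := by
  rw [isExactEndomorphism_iff, isTailTrivial_add_const_iff_forall_exists A hT hA c]
  exact ⟨fun h ↦ h.2, fun h ↦ ⟨measurePreserving_add_const A hT hA c, h⟩⟩

include hT in
/-- **«An affine map is exact if and only if its linear part is»** (Andersen–Thomsen, proof of Theorem 4.3), here
for Rohlin's exactness with respect to the Haar probability measure: `S x = T_A x + c` is an exact endomorphism iff
`T_A` is (`det A ≠ 0`; both are equivalent to `⋂ₙ ℤ^d Aⁿ = 0`).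
[cite: AndersenThomsen2012, §4 proof of Theorem 4.3 (held text arXiv:1204.0224 chunk p0010)]
[cite: Walters1982, §4.9 Definition 4.14 (held text chunk p0126)] -/
theorem isExactEndomorphism_add_const_iff (hA : A.det ≠ 0) (c : UnitAddTorus d) :
    IsExactEndomorphism (fun y ↦ T y + c) volume ↔ IsExactEndomorphism T volume := by
  rw [isExactEndomorphism_add_const_iff_forall_exists A hT hA c, isExactEndomorphism_iff_forall_exists A hT hA]

include hT in
/-- **Andersen–Thomsen, Theorem 4.3 (1)–(2), measure-theoretic form: the affine map `S x = T_A x + c` (`det A ≠ 0`)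
is an exact endomorphism of `(𝕋^d, Haar)` iff no unimodular polynomial divides `χ_A`** (Krzyżewski's criterion for
the linear part). [cite: AndersenThomsen2012, §4 Theorem 4.3 (1)–(2) with Theorem 4.1 (held text arXiv:1204.0224 chunk p0010)]
[cite: Krzyzewski1993, Theorem (abstract)] -/
theorem isExactEndomorphism_add_const_iff_forall_not_dvd_charpoly (hA : A.det ≠ 0) (c : UnitAddTorus d) :
    IsExactEndomorphism (fun y ↦ T y + c) volume ↔
      ∀ g : ℤ[X], g.Monic → 0 < g.natDegree → IsUnit (g.coeff 0) → ¬ g ∣ A.charpoly := by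
  rw [isExactEndomorphism_add_const_iff A hT hA c, isExactEndomorphism_iff_forall_not_dvd_charpoly A hT hA]

include hT in
/-- **Expanding affine maps are exact**: if every complex eigenvalue of `A` has modulus `> 1` then every
`S x = T_A x + c` is an exact endomorphism (Theorem 4.3 (1): «every affine local homeomorphism of `𝕋ⁿ` with `φ_A`
as linear part is exact» when no unimodular polynomial divides `f_A`).
[cite: AndersenThomsen2012, §4 Theorem 4.3 (1) (held text arXiv:1204.0224 chunk p0010)] -/
theorem isExactEndomorphism_add_const_of_forall_one_lt_norm
    (hexp : ∀ α ∈ (A.map (Int.castRingHom ℂ)).charpoly.roots, 1 < ‖α‖) (c : UnitAddTorus d) :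
    IsExactEndomorphism (fun y ↦ T y + c) volume :=
  (isExactEndomorphism_add_const_iff A hT (det_ne_zero_of_forall_one_lt_norm A hexp) c).2
    (isExactEndomorphism_of_forall_one_lt_norm A hT hexp)

include hT in
/-- **Affine maps with unimodular linear part are never exact**: if `det A = ±1` (`d ≠ ∅`) then no
`S x = T_A x + c` is an exact endomorphism. [cite: AndersenThomsen2012, §4 Theorem 4.3 (2) (held text arXiv:1204.0224 chunk p0010)]
[cite: Walters1982, §4.9 Definition 4.14 and the remark after it (held text chunk p0126)] -/
theorem not_isExactEndomorphism_add_const_of_isUnit_det [Nonempty d] (hA : IsUnit A.det) (c : UnitAddTorus d) :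
    ¬ IsExactEndomorphism (fun y ↦ T y + c) volume := by
  rw [isExactEndomorphism_add_const_iff A hT hA.ne_zero c]
  exact not_isExactEndomorphism_of_isUnit_det A hT hA

include hT in
/-- **An exact affine map of the torus is strong-mixing** (Walters: «exact endomorphisms […] are strong-mixing»,
verified for `S x = T_A x + c`, `det A ≠ 0`: exact ⟹ `T_A` exact ⟹ `T_A` ergodic ⟹ `S` strong-mixing by
Theorem 1.29). [cite: Walters1982, §4.9 remark after Definition 4.14 and §1.7 Theorem 1.29 (held text chunks p0126, p0063)] -/
theorem mixing_add_const_of_isExactEndomorphism (hA : A.det ≠ 0) (c : UnitAddTorus d)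
    (h : IsExactEndomorphism (fun y ↦ T y + c) volume) :
    ∀ s t : Set (UnitAddTorus d), MeasurableSet s → MeasurableSet t →
      Tendsto (fun n : ℕ ↦ volume ((fun y ↦ T y + c)^[n] ⁻¹' s ∩ t)) atTop (𝓝 (volume s * volume t)) :=
  (mixing_add_const_iff_ergodic A hT hA c).2 ((isExactEndomorphism_add_const_iff A hT hA c).1 h).ergodic

include hT in
/-- **An exact toral endomorphism `T_A` is strong-mixing** (the case `c = 0`).
[cite: Walters1982, §4.9 remark after Definition 4.14 and §1.7 Theorem 1.29 (held text chunks p0126, p0063)] -/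
theorem mixing_of_isExactEndomorphism (hA : A.det ≠ 0) (h : IsExactEndomorphism T volume) :
    ∀ s t : Set (UnitAddTorus d), MeasurableSet s → MeasurableSet t →
      Tendsto (fun n : ℕ ↦ volume (T^[n] ⁻¹' s ∩ t)) atTop (𝓝 (volume s * volume t)) := by
  have hS : (fun y ↦ T y + (0 : UnitAddTorus d)) = T := funext fun y ↦ add_zero (T y)
  have h' : IsExactEndomorphism (fun y ↦ T y + (0 : UnitAddTorus d)) volume := by rwa [hS]
  have hmix := mixing_add_const_of_isExactEndomorphism A hT hA 0 h'
  rwa [hS] at hmix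

end ToralEndomorphism

end Literature.Dynamics.Ergodic
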